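import Summits.CriticalPhenomena.PercolationContinuityZ3.Theorems.PercNearOneGluingNoHeavyQuantWideCellPieceE
import HarnessLib

/-!
# QUANT lane R8, T-DEC: the WIDE CELL of `LightSliceWide` — piece E with `M1` a mid, and THE FOUR CELL INEQUALITIES `WideCell.main_*`
# (census-2 g60)

builds on p205010 (kernel theorem, internal audit signed; external expert review pending)

Support file (`--supports stmt-CriticalPhenomena-4575`), QUANT lane seat prim-quant-census-2 (gen 60), rung R8 of `…/quant/LADDER.md`.
Memo `run/shared/lean/prim/quant/prim-quant-census-2-g60/WIDE-G60.md`.  Theorems only, standard axioms, no sorries, no definitions.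
Setting as in `…QuantWideCellPieceC` / `…PieceE`.
* `pieceE_mid` (`PG` a mid, `M1` a mid): `(1−γ)m_E α_{P1} ≤ β_G·(1−γ)m_E c₁ + β_1·γ m_E + γ m_E + γ m_C ((x−c)/(1+x−c))·θ`.
* **`main_gl`, `main_gm`, `main_ml`, `main_mm`** — the dual (price) inequality of the eight-term light slice in the four sub-cases
  (`PG = p + h` a Giant or a Mid) × (`M1 = m + l` a conv-Low or a Mid): for all prices `β ≥ 0` on the mids of the cell and values `α` of the
  lows with `α ≤ 1`, `α ≤ usage·β` on the compatible low–mid pairs OF THE SAME PIECE,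
  `Σ_lows mass·α ≤ Σ_mids β·mass + ((1−x)/x)·(giant mass)`.
  These are exactly the hypotheses `decAtT_of_prices_terms` (`…QuantPricesTerms`) asks for; the class theorem `…QuantLightSliceWideHolds`
  supplies the closed forms.  EXACT EVIDENCE before the proof (memo §2): the cell LP has 0 failures on 26 000 boundary-pushed samples of the
  relaxed six-variable region, and the PURE split (no cross pairs, shared giants) already has 0 failures.

[this work].  The gluing rows served [cite: KozmaNitzan2024, Conjecture 3 (p. 15)]; product measure [cite: Grimmett1999, §1.3 p. 10].
-/

noncomputable section

namespace Summit.CriticalPhenomena.PercolationContinuityZ3.Theorems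

namespace Quant

namespace LawDec

namespace WideCell

/-- light usage `U_ℓ(ρ) = (x² + (1−x)ρ)/((1−x)(1+x−ρ))` -/
local notation3 "UL[" x ", " ρ "]" => ((x : ℝ) ^ 2 + (1 - x) * ρ) / ((1 - x) * (1 + x - ρ))

/-! ### piece E with `M1` a mid -/

set_option maxHeartbeats 1600000 in
/-- algebraic core of `pieceE_mid` (compatible `P1 → PG`). [this work] -/
theorem mid_core (x c r a γ ρe w θ mE mC c₁ US : ℝ) (hγ0 : 0 ≤ γ) (hmC : 0 ≤ mC) (hUS0 : 0 < US)
    (hxc0 : 0 ≤ x - c) (h1x : 0 < 1 - x) (hs0 : 0 < 1 - ρe) (hρx : 0 < ρe - x) (hwra : 0 < w + r * a) (haθ : a ≤ θ * (w + r * a))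
    (hκ : mE * ((1 + x - c) * (ρe - x)) = mC * ((x - c) * (1 - ρe)))
    (hUSc : (US - c₁) * ((1 - ρe) * (w + r * a)) = US * (r * a)) (key : (1 - γ) * (r * a) ≤ (1 - x) * γ * a) :
    ((1 - γ) * mE * (US - c₁) - γ * mE * θ * US) * (1 + x - c) ≤ γ * mC * (x - c) * θ * US := by
  have hpos : 0 < (ρe - x) * ((1 - ρe) * (w + r * a)) := mul_pos hρx (mul_pos hs0 hwra)
  refine le_of_mul_le_mul_right ?_ hpos
  have hA : (1 - γ) * mE * (US - c₁) * (1 + x - c) * ((ρe - x) * ((1 - ρe) * (w + r * a)))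
      = (1 - γ) * (US * (r * a)) * (mC * ((x - c) * (1 - ρe))) := by
    calc (1 - γ) * mE * (US - c₁) * (1 + x - c) * ((ρe - x) * ((1 - ρe) * (w + r * a)))
        = (1 - γ) * ((US - c₁) * ((1 - ρe) * (w + r * a))) * (mE * ((1 + x - c) * (ρe - x))) := by ring
      _ = (1 - γ) * (US * (r * a)) * (mC * ((x - c) * (1 - ρe))) := by rw [hUSc, hκ]
  have hB : γ * mE * θ * US * (1 + x - c) * ((ρe - x) * ((1 - ρe) * (w + r * a)))
      = γ * θ * US * ((1 - ρe) * (w + r * a)) * (mC * ((x - c) * (1 - ρe))) := by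
    calc γ * mE * θ * US * (1 + x - c) * ((ρe - x) * ((1 - ρe) * (w + r * a)))
        = γ * θ * US * ((1 - ρe) * (w + r * a)) * (mE * ((1 + x - c) * (ρe - x))) := by ring
      _ = γ * θ * US * ((1 - ρe) * (w + r * a)) * (mC * ((x - c) * (1 - ρe))) := by rw [hκ]
  -- the scalar inequality `(1−γ) ra ≤ γ θ (1−x)(w+ra)`
  have sc : (1 - γ) * (r * a) ≤ γ * θ * (1 - x) * (w + r * a) := by
    have := mul_le_mul_of_nonneg_left haθ (mul_nonneg h1x.le hγ0)
    nlinarith [key, this]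
  have hsc := mul_le_mul_of_nonneg_left sc (mul_nonneg (mul_nonneg hUS0.le hmC) (mul_nonneg hxc0 hs0.le))
  linarith [hA, hB, hsc]

set_option maxHeartbeats 1600000 in
/-- **PIECE E, `PG` a mid and `M1` a mid.**  See the module docstring. [this work] -/
theorem pieceE_mid (x r c a γ ρe w mE mC c₁ c₂ ρS US U1 βG β1 αP1 : ℝ) (cS c1 : Prop) [Decidable cS] [Decidable c1]
    (hγ : γ = x ^ 2 + (1 - x) * r) (hx0 : 0 < x) (hx1 : x < 1) (hr0 : 0 ≤ r) (hrx : r < x) (hcx : c < x)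
    (ha0 : 0 < a) (ha4 : 4 * a ≤ 1) (hρe : x < ρe) (hρe1 : ρe < 1) (hwe : ρe < w)
    (hmE : 0 ≤ mE) (hmC : 0 < mC) (hc₁ : c₁ = ρe / (1 - ρe)) (hc₂ : c₂ = UL[x, c])
    (hbal : mE * (c₁ - x / (1 - x)) = mC * (x / (1 - x) - c₂))
    (hρS : ρS = ρe * (w + r * a) / w) (hcS : cS ↔ ρS < 1) (hUS : ρS < 1 → US = ρS / (1 - ρS))
    (hc1 : c1 ↔ w + r * a < a) (hU1 : w + r * a < a → U1 = ((w + r * a) / a) / (1 - (w + r * a) / a))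
    (hβG : 0 ≤ βG) (hβ1 : 0 ≤ β1) (hαP1 : αP1 ≤ 1) (hαS : cS → αP1 ≤ US * βG) (hα1 : c1 → αP1 ≤ U1 * β1) :
    (1 - γ) * mE * αP1 ≤ βG * ((1 - γ) * mE * c₁) + β1 * (γ * mE) + γ * mE
      + γ * mC * ((x - c) / (1 + x - c)) * (if c1 then a / (w + r * a) else 1) := by
  have hγ0 : 0 ≤ γ := by rw [hγ]; nlinarith
  have hγ1 : γ < 1 := by rw [hγ]; nlinarith
  have h1x : 0 < 1 - x := by linarith
  have hρe0 : 0 < ρe := by linarith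
  have hs0 : 0 < 1 - ρe := by linarith
  have hw0 : 0 < w := by linarith
  have hra : 0 ≤ r * a := mul_nonneg hr0 ha0.le
  have hwra : 0 < w + r * a := by linarith
  have hxc : 0 < 1 + x - c := by linarith
  have hxc0 : 0 ≤ x - c := by linarith
  have hκ := kappa_id x c ρe mE mC c₁ c₂ hx1 hcx hρe1 hc₁ hc₂ hbal
  have hc₁0 : 0 < c₁ := by rw [hc₁]; exact div_pos hρe0 hs0
  have hcap0 : 0 ≤ (1 - γ) * mE * c₁ := mul_nonneg (mul_nonneg (by linarith) hmE) hc₁0.le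
  have hbase0 : 0 ≤ γ * mC * ((x - c) / (1 + x - c)) := mul_nonneg (mul_nonneg hγ0 hmC.le) (div_nonneg hxc0 hxc.le)
  -- the factor `θ`
  obtain ⟨θ, hθ⟩ : ∃ θ : ℝ, θ = (if c1 then a / (w + r * a) else 1) := ⟨_, rfl⟩
  rw [← hθ]
  have hθ1 : 1 ≤ θ := by
    rw [hθ]; split_ifs with h
    · rw [le_div_iff₀ hwra]; linarith [hc1.1 h]
    · exact le_rfl
  have hθ0 : 0 ≤ θ := by linarith
  have haθ : a ≤ θ * (w + r * a) := by
    rw [hθ]; split_ifs with h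
    · rw [div_mul_cancel₀ _ hwra.ne']
    · have : ¬ (w + r * a < a) := fun hh => h (hc1.2 hh)
      push Not at this; linarith
  have hextra0 : 0 ≤ γ * mC * ((x - c) / (1 + x - c)) * θ := mul_nonneg hbase0 hθ0
  -- absorbable amounts
  obtain ⟨qG, hqG⟩ : ∃ qG : ℝ, qG = (if cS then (1 - γ) * mE * c₁ / US else 0) := ⟨_, rfl⟩
  obtain ⟨q1, hq1⟩ : ∃ q1 : ℝ, q1 = (if c1 then γ * mE / U1 else 0) := ⟨_, rfl⟩
  have hUS0 : cS → 0 < US := by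
    intro h; rw [hUS (hcS.1 h)]
    have hρS1 := hcS.1 h
    have hρSe : ρe ≤ ρS := by rw [hρS, le_div_iff₀ hw0]; nlinarith
    exact div_pos (by linarith) (by linarith)
  have hU10 : c1 → 0 < U1 := by
    intro h
    have hlt := hc1.1 h
    rw [hU1 hlt]
    have hσ0 : 0 < (w + r * a) / a := div_pos hwra ha0
    have hσ1 : (w + r * a) / a < 1 := by rw [div_lt_one ha0]; exact hlt
    exact div_pos hσ0 (by linarith)
  have hqG0 : 0 ≤ qG := by
    rw [hqG]; split_ifs with h
    · exact div_nonneg hcap0 (hUS0 h).le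
    · exact le_rfl
  have hq10 : 0 ≤ q1 := by
    rw [hq1]; split_ifs with h
    · exact div_nonneg (mul_nonneg hγ0 hmE) (hU10 h).le
    · exact le_rfl
  have hqGα : qG * αP1 ≤ βG * ((1 - γ) * mE * c₁) := by
    rw [hqG]; split_ifs with h
    · have hU := hUS0 h
      have := mul_le_mul_of_nonneg_left (hαS h) (div_nonneg hcap0 hU.le)
      have e : (1 - γ) * mE * c₁ / US * (US * βG) = βG * ((1 - γ) * mE * c₁) := by field_simp
      linarith
    · rw [zero_mul]; exact mul_nonneg hβG hcap0
  have hq1α : q1 * αP1 ≤ β1 * (γ * mE) := by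
    rw [hq1]; split_ifs with h
    · have hU := hU10 h
      have := mul_le_mul_of_nonneg_left (hα1 h) (div_nonneg (mul_nonneg hγ0 hmE) hU.le)
      have e : γ * mE / U1 * (U1 * β1) = β1 * (γ * mE) := by field_simp
      linarith
    · rw [zero_mul]; exact mul_nonneg hβ1 (mul_nonneg hγ0 hmE)
  have hRHS0 : 0 ≤ βG * ((1 - γ) * mE * c₁) + β1 * (γ * mE) + γ * mE + γ * mC * ((x - c) / (1 + x - c)) * θ :=
    add_nonneg (add_nonneg (add_nonneg (mul_nonneg hβG hcap0) (mul_nonneg hβ1 (mul_nonneg hγ0 hmE))) (mul_nonneg hγ0 hmE)) hextra0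
  rcases lt_or_ge αP1 0 with hαneg | hαnn
  · have : (1 - γ) * mE * αP1 ≤ 0 := mul_nonpos_of_nonneg_of_nonpos (mul_nonneg (by linarith) hmE) hαneg.le
    linarith
  rcases le_or_gt ((1 - γ) * mE - qG - q1) 0 with hneg | hposR
  · -- the mids absorb everything
    have hle : (1 - γ) * mE ≤ qG + q1 := by linarith
    have := mul_le_mul_of_nonneg_right hle hαnn
    nlinarith [mul_nonneg hγ0 hmE]
  -- leftover `R_E = (1−γ)m_E − qG − q1 > 0`
  have e : (1 - γ) * mE * αP1 = qG * αP1 + q1 * αP1 + ((1 - γ) * mE - qG - q1) * αP1 := by ring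
  have h3 : ((1 - γ) * mE - qG - q1) * αP1 ≤ (1 - γ) * mE - qG - q1 := mul_le_of_le_one_right hposR.le hαP1
  -- it remains: `(1−γ)mE − qG − q1 ≤ γ mE + γ m_C ((x−c)/(1+x−c)) θ`
  suffices hrest : (1 - γ) * mE - qG - q1 ≤ γ * mE + γ * mC * ((x - c) / (1 + x - c)) * θ by linarith
  -- `q1 + γ mE = γ mE θ`
  have hq1θ : q1 + γ * mE = γ * mE * θ := by
    rw [hq1, hθ]; split_ifs with h
    · rw [hU1 (hc1.1 h)]
      field_simp
      ring
    · ring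
  by_cases hS : cS
  · have hρS1 := hcS.1 hS
    have hUSv := hUS hρS1
    have hU := hUS0 hS
    have hqGv : qG = (1 - γ) * mE * c₁ / US := by rw [hqG, if_pos hS]
    have hUSc : (US - c₁) * ((1 - ρe) * (w + r * a)) = US * (r * a) := by
      have hden : w - ρe * (w + r * a) ≠ 0 := by
        have : ρe * (w + r * a) < w := by have h := hρS1; rw [hρS, div_lt_one hw0] at h; exact h
        linarith
      have hUS' : US = ρe * (w + r * a) / (w - ρe * (w + r * a)) := by rw [hUSv, hρS]; field_simp
      rw [hUS', hc₁]
      field_simp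
      ring
    have hX := mid_core x c r a γ ρe w θ mE mC c₁ US hγ0 hmC.le hU hxc0 h1x hs0 (by linarith) hwra haθ hκ hUSc
      (key_ra x r a γ hγ hx1 ha0.le)
    -- `(1−γ)mE − capG/US − q1 − γ mE − γ mC ((x−c)/(1+x−c)) θ = [((1−γ)mE(US−c₁) − γ mE θ US)(1+x−c) − γ mC (x−c) θ US]/(US (1+x−c))`
    have e2 : (1 - γ) * mE - qG - q1 - (γ * mE + γ * mC * ((x - c) / (1 + x - c)) * θ)
        = (((1 - γ) * mE * (US - c₁) - γ * mE * θ * US) * (1 + x - c) - γ * mC * (x - c) * θ * US) / (US * (1 + x - c)) := by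
      rw [hqGv, show q1 = γ * mE * θ - γ * mE by linarith [hq1θ]]
      field_simp
      ring
    have : (1 - γ) * mE - qG - q1 - (γ * mE + γ * mC * ((x - c) / (1 + x - c)) * θ) ≤ 0 := by
      rw [e2]; exact div_nonpos_of_nonpos_of_nonneg (by linarith) (mul_pos hU hxc).le
    linarith
  · -- `P1 → PG` incompatible
    have hρS1 : 1 ≤ ρS := by by_contra h; push Not at h; exact hS (hcS.2 h)
    have hqGv : qG = 0 := by rw [hqG, if_neg hS]
    rw [hqGv, sub_zero]
    by_cases hg : 1 ≤ 2 * γ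
    · have : (1 - γ) * mE ≤ γ * mE := mul_le_mul_of_nonneg_right (by linarith) hmE
      linarith
    · push Not at hg
      have hs : 1 - ρe ≤ r * a := by
        have h1 : w ≤ ρe * (w + r * a) := by rw [hρS, le_div_iff₀ hw0] at hρS1; linarith
        have h2 : ρe * (r * a) ≤ w * (r * a) := mul_le_mul_of_nonneg_right hwe.le hra
        have h3' : (1 - ρe) * w ≤ (r * a) * w := by linarith
        exact le_of_mul_le_mul_right h3' hw0
      have t := incompat_core x c r a γ ρe mE mC hγ hx0 hx1 hr0 hrx hcx ha0 ha4 hρe hρe1 hmC.le hκ hs hg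
      have t2 : γ * mC * ((x - c) / (1 + x - c)) ≤ γ * mC * ((x - c) / (1 + x - c)) * θ := le_mul_of_one_le_right hbase0 hθ1
      have h0 : 0 ≤ γ * mE := mul_nonneg hγ0 hmE
      linarith

/-! ### the four cell inequalities -/

/-- giants-budget identity used by all four: `m_E c₁ + m_C c₂ = u (m_E + m_C)` (balance). -/
theorem giants_eq (x mE mC c₁ c₂ : ℝ) (hx0 : 0 < x) (hx1 : x < 1) (hbal : mE * (c₁ - x / (1 - x)) = mC * (x / (1 - x) - c₂)) :
    ((1 - x) / x) * (mE * c₁ + mC * c₂) = mE + mC := by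
  have h1x : (1:ℝ) - x ≠ 0 := by linarith
  have hx : x ≠ 0 := hx0.ne'
  field_simp
  field_simp at hbal
  linear_combination hbal

set_option maxHeartbeats 800000 in
/-- **THE WIDE CELL, `PG` a giant** (then `M1` low or mid alike: the expensive piece is priced at `1`). [this work] -/
theorem main_g (x r c a γ ρe ρP mE mC c₁ c₂ UH UM βH βM αP1 αP2 αM1 E : ℝ) (cM : Prop) [Decidable cM]
    (hγ : γ = x ^ 2 + (1 - x) * r) (hx0 : 0 < x) (hx1 : x < 1) (hr0 : 0 ≤ r) (hrx : r < x) (hc0 : 0 ≤ c) (hcx : c < x)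
    (ha0 : 0 < a) (ha4 : 4 * a ≤ 1) (hρP : ρP = c + r * a) (hρP1 : ρP < 1) (hρe : x < ρe) (hρe1 : ρe < 1)
    (hmE : 0 ≤ mE) (hmC : 0 < mC) (hc₂ : c₂ = UL[x, c])
    (hbal : mE * (c₁ - x / (1 - x)) = mC * (x / (1 - x) - c₂))
    (hUHl : ρP ≤ x → UH = UL[x, ρP]) (hUHh : x ≤ ρP → UH = ρP / (1 - ρP))
    (hcM : cM ↔ ρP < a) (hUMl : ρP / a ≤ x → ρP < a → UM = UL[x, ρP / a]) (hUMh : x ≤ ρP / a → ρP < a → UM = (ρP / a) / (1 - ρP / a))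
    (hβH : 0 ≤ βH) (hβM : 0 ≤ βM) (hαP1 : αP1 ≤ 1) (hαP2 : αP2 ≤ 1) (hαM1 : αM1 ≤ 1)
    (hαH : αP2 ≤ UH * βH) (hαM : cM → αP2 ≤ UM * βM) (hE : E ≤ (1 - γ) * mE * αP1 + γ * mE * αM1) :
    E + (1 - γ) * mC * αP2
      ≤ βH * ((1 - γ) * mC * c₂) + βM * (γ * mC) + ((1 - x) / x) * (γ * mC * c₂ + γ * mE * c₁ + (1 - γ) * mE * c₁) := by
  have hγ0 : 0 ≤ γ := by rw [hγ]; nlinarith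
  have hγ1 : γ < 1 := by rw [hγ]; nlinarith
  have h1x : 0 < 1 - x := by linarith
  have hR := restC_le x r c a γ ρP c₂ UH UM cM hγ hx0 hx1 hr0 hrx hc0 hcx ha0 (by linarith) hρP hc₂ hUHl hUHh hcM hUMl hUMh
  have hC := pieceC x r c a γ ρP mC c₂ UH UM βH βM αP2 (γ / (1 + x - c)) cM hγ hx0 hx1 hr0 hrx hc0 hcx ha0 hρP hρP1 hmC hc₂ hUHl
    hUHh hcM hUMl hUMh hβH hβM hαP2 hαH hαM hR
  -- piece E is priced at `1`
  have hE1 : E ≤ mE := by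
    have h1 : (1 - γ) * mE * αP1 ≤ (1 - γ) * mE := mul_le_of_le_one_right (mul_nonneg (by linarith) hmE) hαP1
    have h2 : γ * mE * αM1 ≤ γ * mE := mul_le_of_le_one_right (mul_nonneg hγ0 hmE) hαM1
    linarith
  -- the giants: `((1−x)/x)(γ mC c₂ + mE c₁) = mE + mC − (1−γ) mC c₂ (1−x)/x ≥ mE + γ mC ≥ mE + mC γ/(1+x−c)`
  have hG := giants_eq x mE mC c₁ c₂ hx0 hx1 hbal
  have hc₂u : c₂ ≤ x / (1 - x) := by rw [hc₂]; exact CrossGiantCell.Ul_le_u x c hx0 hx1 hcx.le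
  have t1 : ((1 - x) / x) * ((1 - γ) * mC * c₂) ≤ (1 - γ) * mC := by
    have h0 : 0 ≤ (1 - γ) * mC := mul_nonneg (by linarith) hmC.le
    have := mul_le_mul_of_nonneg_left hc₂u h0
    have e : ((1 - x) / x) * ((1 - γ) * mC * (x / (1 - x))) = (1 - γ) * mC := by field_simp
    have hpos : 0 ≤ (1 - x) / x := div_nonneg h1x.le hx0.le
    nlinarith [mul_le_mul_of_nonneg_left this hpos]
  have t2 : mC * (γ / (1 + x - c)) ≤ γ * mC := by
    rw [mul_div_assoc', div_le_iff₀ (by linarith : (0:ℝ) < 1 + x - c)]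
    have : 0 ≤ γ * mC * (x - c) := mul_nonneg (mul_nonneg hγ0 hmC.le) (by linarith)
    nlinarith
  have e : ((1 - x) / x) * (γ * mC * c₂ + γ * mE * c₁ + (1 - γ) * mE * c₁)
      = ((1 - x) / x) * (mE * c₁ + mC * c₂) - ((1 - x) / x) * ((1 - γ) * mC * c₂) := by ring
  linarith [hC, hE1, hG, t1, t2, e]

set_option maxHeartbeats 800000 in
/-- **THE WIDE CELL, `PG` a mid, `M1` a conv-low.** [this work] -/
theorem main_ml (x r c a γ ρe w ρP mE mC c₁ c₂ ρS ρN UH UM US UN βH βM βG αP1 αP2 αM1 : ℝ) (cM cS : Prop) [Decidable cM]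
    (hγ : γ = x ^ 2 + (1 - x) * r) (hx0 : 0 < x) (hx1 : x < 1) (hr0 : 0 ≤ r) (hrx : r < x) (hc0 : 0 ≤ c) (hcx : c < x)
    (ha0 : 0 < a) (ha4 : 4 * a ≤ 1) (hρP : ρP = c + r * a) (hρP1 : ρP < 1) (hρe : x < ρe) (hρe1 : ρe < 1) (hwe : ρe < w)
    (hlow : 2 * a < w + r * a) (hmE : 0 ≤ mE) (hmC : 0 < mC) (hc₁ : c₁ = ρe / (1 - ρe)) (hc₂ : c₂ = UL[x, c])
    (hbal : mE * (c₁ - x / (1 - x)) = mC * (x / (1 - x) - c₂))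
    (hUHl : ρP ≤ x → UH = UL[x, ρP]) (hUHh : x ≤ ρP → UH = ρP / (1 - ρP))
    (hcM : cM ↔ ρP < a) (hUMl : ρP / a ≤ x → ρP < a → UM = UL[x, ρP / a]) (hUMh : x ≤ ρP / a → ρP < a → UM = (ρP / a) / (1 - ρP / a))
    (hρS : ρS = ρe * (w + r * a) / w) (hcS : cS ↔ ρS < 1) (hUS : ρS < 1 → US = ρS / (1 - ρS))
    (hρN : ρN = ρe * (w + r * a - 2 * a) / (w - a * ρe)) (hUNl : ρN ≤ x → UN = UL[x, ρN]) (hUNh : x ≤ ρN → UN = ρN / (1 - ρN))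
    (hβH : 0 ≤ βH) (hβM : 0 ≤ βM) (hβG : 0 ≤ βG) (hαP1 : αP1 ≤ 1) (hαP2 : αP2 ≤ 1) (hαM1 : αM1 ≤ 1)
    (hαH : αP2 ≤ UH * βH) (hαM : cM → αP2 ≤ UM * βM) (hαS : cS → αP1 ≤ US * βG) (hαN : αM1 ≤ UN * βG) :
    (1 - γ) * mE * αP1 + (1 - γ) * mC * αP2 + γ * mE * αM1
      ≤ βH * ((1 - γ) * mC * c₂) + βM * (γ * mC) + βG * ((1 - γ) * mE * c₁) + ((1 - x) / x) * (γ * mC * c₂ + γ * mE * c₁) := by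
  have hγ0 : 0 ≤ γ := by rw [hγ]; nlinarith
  have hR := restC_le x r c a γ ρP c₂ UH UM cM hγ hx0 hx1 hr0 hrx hc0 hcx ha0 (by linarith) hρP hc₂ hUHl hUHh hcM hUMl hUMh
  have hC := pieceC x r c a γ ρP mC c₂ UH UM βH βM αP2 (γ / (1 + x - c)) cM hγ hx0 hx1 hr0 hrx hc0 hcx ha0 hρP hρP1 hmC hc₂ hUHl
    hUHh hcM hUMl hUMh hβH hβM hαP2 hαH hαM hR
  have hEl := pieceE_low x r c a γ ρe w mE mC c₁ c₂ ρS ρN US UN βG αP1 αM1 cS hγ hx0 hx1 hr0 hrx hcx ha0 ha4 hρe hρe1 hwe hlow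
    hmE hmC hc₁ hc₂ hbal hρS hcS hUS hρN hUNl hUNh hβG hαP1 hαM1 hαS hαN
  have hG := giants_eq x mE mC c₁ c₂ hx0 hx1 hbal
  have e1 : ((1 - x) / x) * (γ * mC * c₂ + γ * mE * c₁) = γ * (mE + mC) := by rw [← hG]; ring
  have hxc' : (1:ℝ) + x - c ≠ 0 := by linarith
  have e2 : γ * mC * ((x - c) / (1 + x - c)) + mC * (γ / (1 + x - c)) = γ * mC := by
    field_simp
    ring
  linarith [hC, hEl, hG, e1, e2]

set_option maxHeartbeats 800000 in
/-- **THE WIDE CELL, `PG` a mid, `M1` a mid.** [this work] -/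
theorem main_mm (x r c a γ ρe w ρP mE mC c₁ c₂ ρS UH UM US U1 βH βM βG β1 αP1 αP2 : ℝ) (cM cS c1 : Prop) [Decidable cM]
    [Decidable cS] [Decidable c1]
    (hγ : γ = x ^ 2 + (1 - x) * r) (hx0 : 0 < x) (hx1 : x < 1) (hr0 : 0 ≤ r) (hrx : r < x) (hc0 : 0 ≤ c) (hcx : c < x)
    (ha0 : 0 < a) (ha4 : 4 * a ≤ 1) (hρP : ρP = c + r * a) (hρP1 : ρP < 1) (hρe : x < ρe) (hρe1 : ρe < 1) (hwe : ρe < w)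
    (hmE : 0 ≤ mE) (hmC : 0 < mC) (hc₁ : c₁ = ρe / (1 - ρe)) (hc₂ : c₂ = UL[x, c])
    (hbal : mE * (c₁ - x / (1 - x)) = mC * (x / (1 - x) - c₂))
    (hUHl : ρP ≤ x → UH = UL[x, ρP]) (hUHh : x ≤ ρP → UH = ρP / (1 - ρP))
    (hcM : cM ↔ ρP < a) (hUMl : ρP / a ≤ x → ρP < a → UM = UL[x, ρP / a]) (hUMh : x ≤ ρP / a → ρP < a → UM = (ρP / a) / (1 - ρP / a))
    (hρS : ρS = ρe * (w + r * a) / w) (hcS : cS ↔ ρS < 1) (hUS : ρS < 1 → US = ρS / (1 - ρS))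
    (hc1 : c1 ↔ w + r * a < a) (hU1 : w + r * a < a → U1 = ((w + r * a) / a) / (1 - (w + r * a) / a))
    (hβH : 0 ≤ βH) (hβM : 0 ≤ βM) (hβG : 0 ≤ βG) (hβ1 : 0 ≤ β1) (hαP1 : αP1 ≤ 1) (hαP2 : αP2 ≤ 1)
    (hαH : αP2 ≤ UH * βH) (hαM : cM → αP2 ≤ UM * βM) (hαS : cS → αP1 ≤ US * βG) (hα1 : c1 → αP1 ≤ U1 * β1) :
    (1 - γ) * mE * αP1 + (1 - γ) * mC * αP2
      ≤ βH * ((1 - γ) * mC * c₂) + βM * (γ * mC) + βG * ((1 - γ) * mE * c₁) + β1 * (γ * mE)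
        + ((1 - x) / x) * (γ * mC * c₂ + γ * mE * c₁) := by
  have hγ0 : 0 ≤ γ := by rw [hγ]; nlinarith
  have hxw : x ≤ w := by linarith
  have hEm := pieceE_mid x r c a γ ρe w mE mC c₁ c₂ ρS US U1 βG β1 αP1 cS c1 hγ hx0 hx1 hr0 hrx hcx ha0 ha4 hρe hρe1 hwe
    hmE hmC hc₁ hc₂ hbal hρS hcS hUS hc1 hU1 hβG hβ1 hαP1 hαS hα1
  have hG := giants_eq x mE mC c₁ c₂ hx0 hx1 hbal
  have e1 : ((1 - x) / x) * (γ * mC * c₂ + γ * mE * c₁) = γ * (mE + mC) := by rw [← hG]; ring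
  by_cases h1 : c1
  · rw [if_pos h1] at hEm
    have hlt : w + r * a < a := hc1.1 h1
    have hRθ := restC_le_theta x r c a γ ρP c₂ UH UM w cM hγ hx0 hx1 hr0 hrx hc0 hcx ha0 (by linarith) hρP hc₂ hUHl hUHh hcM
      hUMl hUMh hxw hlt
    have hC := pieceC x r c a γ ρP mC c₂ UH UM βH βM αP2 (γ - γ * (x - c) * (a / (w + r * a)) / (1 + x - c)) cM hγ hx0 hx1
      hr0 hrx hc0 hcx ha0 hρP hρP1 hmC hc₂ hUHl hUHh hcM hUMl hUMh hβH hβM hαP2 hαH hαM (by linarith [hRθ])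
    have e2 : γ * mC * ((x - c) / (1 + x - c)) * (a / (w + r * a)) + mC * (γ - γ * (x - c) * (a / (w + r * a)) / (1 + x - c))
        = γ * mC := by
      have : (1:ℝ) + x - c ≠ 0 := by linarith
      have : w + r * a ≠ 0 := by nlinarith
      field_simp
      ring
    linarith [hC, hEm, hG, e1, e2]
  · rw [if_neg h1, mul_one] at hEm
    have hR := restC_le x r c a γ ρP c₂ UH UM cM hγ hx0 hx1 hr0 hrx hc0 hcx ha0 (by linarith) hρP hc₂ hUHl hUHh hcM hUMl hUMh
    have hC := pieceC x r c a γ ρP mC c₂ UH UM βH βM αP2 (γ / (1 + x - c)) cM hγ hx0 hx1 hr0 hrx hc0 hcx ha0 hρP hρP1 hmC hc₂ hUHl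
      hUHh hcM hUMl hUMh hβH hβM hαP2 hαH hαM hR
    have hxc' : (1:ℝ) + x - c ≠ 0 := by linarith
    have e2 : γ * mC * ((x - c) / (1 + x - c)) + mC * (γ / (1 + x - c)) = γ * mC := by
      field_simp
      ring
    linarith [hC, hEm, hG, e1, e2]

end WideCell

end LawDec

end Quant

end Summit.CriticalPhenomena.PercolationContinuityZ3.Theorems
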